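import Mathlib
import HarnessLib
import Summits.Ventures.LatticeQCDFlow.Scaling.AbelianHolonomyDetermination

/-!
# LatticeQCDFlow / Scaling — the converse: fewer than `(d−1)(L^d − 1)` plaquette holonomies never
# determine an abelian lattice gauge field; for ranked structures, determination ⇔ full ⇔ optimal

HONEST FRAMING: exact (Metropolis-corrected) sampling algorithms for lattice gauge theory;
figures of merit are autocorrelation/cost numbers at stated couplings and volumes; no
continuum-physics claim.

Venture `LatticeQCDFlow` (cell pub-lqcd), topic `Scaling`, FANOUT row 30 (lean-1, GEN-27) — OUR WORK on
THEORY-2.md §4 row C5 (gen25 Q2, converse).  `Scaling/AbelianHolonomyDetermination`: along a FULL ranked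
structure `B` of `(ℤ/L)^d` (`#B = (d−1)(L^d − 1)`, the optimal ones) the covered holonomies of an ABELIAN
gauge field determine every plaquette holonomy.  Here the converse, for ANY collection `B` of plaquettes —
ranked or not — with `#B < (d−1)(L^d − 1)`:

* §1 over `ℚ`: the signed boundaries of a ranked structure are `ℚ`-independent (top-link pivots,
  `TorusSignedBoundary`), so the `(d−1)(L^d − 1)` boundaries of the Morse structure
  (`TorusRankedMorseCount.exists_ranked_card_compl_eq`) span a space of that dimension, and
  **`exists_signedBoundary_notMem_span_rat`** — some plaquette boundary `σ∂p'` lies OUTSIDE the `ℚ`-span of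
  `{σ∂p : p ∈ B}` whenever `#B < (d−1)(L^d − 1)`;
* §2 **`exists_int_certificate`** (and `…_of_notMem_span` for any given `p'` outside the `ℚ`-span) — an
  INTEGER CERTIFICATE: `θ : links → ℤ` with `Σ_e θ_e·σ∂p(e) = 0` for every `p ∈ B` and
  `n := Σ_e θ_e·σ∂p'(e) ≠ 0` (a separating `ℚ`-linear functional, `Submodule.exists_dual_map_eq_bot_of_notMem`,
  with denominators cleared);
* §3 the configuration `U = g^θ` (`U(e) = g^{θ_e}`, `g` in a commutative `G`) has `U_p = g^{Σ_e θ_e σ∂p(e)}`: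
  holonomy `1` around every `p ∈ B` — like the trivial configuration — and `g^n` around `p'`;
* §4 **`exists_plaquetteHolonomy_not_determined`** — NON-DETERMINATION: if `#B < (d−1)(L^d − 1)` and `G`
  has, for every `n ≠ 0`, an element `g` with `g^n ≠ 1`, there are a plaquette `p' ∉ B` and two
  configurations with the same holonomy around every `p ∈ B` and different holonomies around `p'`;
  **`…_circle`**: the instance `G = U(1)` (`g = e^{iπ/n}`, `g^n = −1`, **`circle_exists_zpow_ne_one`**);
  **`…_int`**: `G = ℤ`;
* §5 **`covered_determine_iff_card_eq`** — FOR RANKED STRUCTURES, DETERMINATION ⇔ FULL: a ranked `B` has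
  `#B ≤ (d−1)(L^d − 1)` (`TorusRankedHomologyBound`), and its covered holonomies determine all plaquette
  holonomies of every `G`-field (`G = U(1)`, or any commutative `G` with some `g^n ≠ 1` for each `n ≠ 0`) iff
  `#B = (d−1)(L^d − 1)` iff (`TorusRankedMorseCount.isLeast_card_compl_ranked`) `B` is optimal — the exact
  one-plaquette heat-bath autoregressions that leave NOTHING random outside are exactly the optimal ones.

No `def`, no `sorry`, nothing cited as a fact beyond the tree.
-/

namespace Summit.Ventures.LatticeQCDFlow.Theory2.Autoregressive

open Finset
open Literature.MathematicalPhysics.QuantumFieldTheory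

variable {d L : ℕ} [NeZero L]

/-! ## §1 Over `ℚ`: a plaquette boundary outside the span of fewer than `(d−1)(L^d−1)` boundaries -/

omit [NeZero L] in
/-- **The signed boundaries of a ranked structure are `ℚ`-independent** (top-link pivots). [ours] -/
theorem linearIndependent_signedBoundary_rat_of_ranked (hL : 2 ≤ L) (B : Finset (Plaquette d L))
    (t : Plaquette d L → Edge d L)
    (ht : ∀ p ∈ B, t p ∈ ({(p.1, p.2.1.1), (p.1.shift p.2.1.1, p.2.1.2),
        (p.1.shift p.2.1.2, p.2.1.1), (p.1, p.2.1.2)} : Finset (Edge d L)))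
    (rank : Plaquette d L → ℕ)
    (hrank : ∀ p ∈ B, ∀ p' ∈ B, p ≠ p' → t p ∈ ({(p'.1, p'.2.1.1), (p'.1.shift p'.2.1.1, p'.2.1.2),
        (p'.1.shift p'.2.1.2, p'.2.1.1), (p'.1, p'.2.1.2)} : Finset (Edge d L)) → rank p < rank p') :
    LinearIndependent ℚ (fun p : B =>
      (Pi.single ((p : Plaquette d L).1, (p : Plaquette d L).2.1.1) 1 +
        Pi.single ((p : Plaquette d L).1.shift (p : Plaquette d L).2.1.1, (p : Plaquette d L).2.1.2) 1 -
        Pi.single ((p : Plaquette d L).1.shift (p : Plaquette d L).2.1.2, (p : Plaquette d L).2.1.1) 1 -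
        Pi.single ((p : Plaquette d L).1, (p : Plaquette d L).2.1.2) 1 : Edge d L → ℚ)) := by
  classical
  rw [Fintype.linearIndependent_iff]
  intro g hg p
  have key := eq_zero_of_sum_smul_signedBoundary_apply_top (R := ℚ) hL B t ht rank hrank
    (fun q => if h : q ∈ B then g ⟨q, h⟩ else 0) ?_
  · have h : (if h : (p : Plaquette d L) ∈ B then g ⟨p, h⟩ else 0) = 0 := key p p.2
    rwa [dif_pos p.2] at h
  · intro q hq
    have hsum : ∑ p' ∈ B, (fun q : Plaquette d L => if h : q ∈ B then g ⟨q, h⟩ else 0) p' •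
        (Pi.single (p'.1, p'.2.1.1) 1 + Pi.single (p'.1.shift p'.2.1.1, p'.2.1.2) 1 -
        Pi.single (p'.1.shift p'.2.1.2, p'.2.1.1) 1 - Pi.single (p'.1, p'.2.1.2) 1 : Edge d L → ℚ) =
        ∑ i : B, g i • (Pi.single ((i : Plaquette d L).1, (i : Plaquette d L).2.1.1) 1 +
        Pi.single ((i : Plaquette d L).1.shift (i : Plaquette d L).2.1.1, (i : Plaquette d L).2.1.2) 1 -
        Pi.single ((i : Plaquette d L).1.shift (i : Plaquette d L).2.1.2, (i : Plaquette d L).2.1.1) 1 -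
        Pi.single ((i : Plaquette d L).1, (i : Plaquette d L).2.1.2) 1 : Edge d L → ℚ) := by
      rw [← Finset.sum_coe_sort B]
      refine Finset.sum_congr rfl fun i _ => ?_
      dsimp only
      rw [dif_pos i.2]
    rw [hsum, hg, Pi.zero_apply]

/-- **Some plaquette boundary lies outside the `ℚ`-span of fewer than `(d−1)(L^d − 1)` boundaries**
(`L ≥ 2`; `B` arbitrary with `#B < (d−1)(L^d − 1)`): the boundaries of the Morse structure are
`(d−1)(L^d − 1)` independent vectors, too many for the span of `B`. [ours] -/
theorem exists_signedBoundary_notMem_span_rat (hL : 2 ≤ L) (B : Finset (Plaquette d L))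
    (hlt : B.card < (d - 1) * (L ^ d - 1)) :
    ∃ p' : Plaquette d L, (Pi.single (p'.1, p'.2.1.1) 1 + Pi.single (p'.1.shift p'.2.1.1, p'.2.1.2) 1 -
        Pi.single (p'.1.shift p'.2.1.2, p'.2.1.1) 1 - Pi.single (p'.1, p'.2.1.2) 1 : Edge d L → ℚ) ∉
      Submodule.span ℚ (Set.range fun p : B =>
        (Pi.single ((p : Plaquette d L).1, (p : Plaquette d L).2.1.1) 1 +
        Pi.single ((p : Plaquette d L).1.shift (p : Plaquette d L).2.1.1, (p : Plaquette d L).2.1.2) 1 -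
        Pi.single ((p : Plaquette d L).1.shift (p : Plaquette d L).2.1.2, (p : Plaquette d L).2.1.1) 1 -
        Pi.single ((p : Plaquette d L).1, (p : Plaquette d L).2.1.2) 1 : Edge d L → ℚ)) := by
  classical
  by_contra hall
  push Not at hall
  obtain ⟨M, tM, rM, -, htM, hrM, -, hcardM⟩ := exists_ranked_card_compl_eq (d := d) hL
  have hliM := linearIndependent_signedBoundary_rat_of_ranked hL M tM htM rM hrM
  set W := Submodule.span ℚ (Set.range fun p : B =>
        (Pi.single ((p : Plaquette d L).1, (p : Plaquette d L).2.1.1) 1 +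
        Pi.single ((p : Plaquette d L).1.shift (p : Plaquette d L).2.1.1, (p : Plaquette d L).2.1.2) 1 -
        Pi.single ((p : Plaquette d L).1.shift (p : Plaquette d L).2.1.2, (p : Plaquette d L).2.1.1) 1 -
        Pi.single ((p : Plaquette d L).1, (p : Plaquette d L).2.1.2) 1 : Edge d L → ℚ)) with hW
  have hle : Submodule.span ℚ (Set.range fun p : M =>
      (Pi.single ((p : Plaquette d L).1, (p : Plaquette d L).2.1.1) 1 +
        Pi.single ((p : Plaquette d L).1.shift (p : Plaquette d L).2.1.1, (p : Plaquette d L).2.1.2) 1 -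
        Pi.single ((p : Plaquette d L).1.shift (p : Plaquette d L).2.1.2, (p : Plaquette d L).2.1.1) 1 -
        Pi.single ((p : Plaquette d L).1, (p : Plaquette d L).2.1.2) 1 : Edge d L → ℚ)) ≤ W := by
    rw [Submodule.span_le]
    rintro _ ⟨p, rfl⟩
    exact hall p
  have h1 : Module.finrank ℚ (Submodule.span ℚ (Set.range fun p : M =>
      (Pi.single ((p : Plaquette d L).1, (p : Plaquette d L).2.1.1) 1 +
        Pi.single ((p : Plaquette d L).1.shift (p : Plaquette d L).2.1.1, (p : Plaquette d L).2.1.2) 1 -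
        Pi.single ((p : Plaquette d L).1.shift (p : Plaquette d L).2.1.2, (p : Plaquette d L).2.1.1) 1 -
        Pi.single ((p : Plaquette d L).1, (p : Plaquette d L).2.1.2) 1 : Edge d L → ℚ))) = M.card := by
    rw [finrank_span_eq_card hliM, Fintype.card_coe]
  have h2 : Module.finrank ℚ W ≤ B.card := by
    have h := finrank_range_le_card (R := ℚ) (fun p : B =>
      (Pi.single ((p : Plaquette d L).1, (p : Plaquette d L).2.1.1) 1 +
        Pi.single ((p : Plaquette d L).1.shift (p : Plaquette d L).2.1.1, (p : Plaquette d L).2.1.2) 1 -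
        Pi.single ((p : Plaquette d L).1.shift (p : Plaquette d L).2.1.2, (p : Plaquette d L).2.1.1) 1 -
        Pi.single ((p : Plaquette d L).1, (p : Plaquette d L).2.1.2) 1 : Edge d L → ℚ))
    rw [Fintype.card_coe] at h
    exact h
  have h3 := Submodule.finrank_mono hle
  omega

/-! ## §2 The integer certificate -/

omit [NeZero L] in
/-- The signed boundary over `ℤ`, cast into any ring, is the signed boundary over that ring. [ours] -/
theorem intCast_signedBoundary_apply_eq {R : Type*} [Ring R] (p : Plaquette d L) (e : Edge d L) :
    ((((Pi.single (p.1, p.2.1.1) 1 + Pi.single (p.1.shift p.2.1.1, p.2.1.2) 1 -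
        Pi.single (p.1.shift p.2.1.2, p.2.1.1) 1 - Pi.single (p.1, p.2.1.2) 1 : Edge d L → ℤ)) e : ℤ) : R) =
      (Pi.single (p.1, p.2.1.1) 1 + Pi.single (p.1.shift p.2.1.1, p.2.1.2) 1 -
        Pi.single (p.1.shift p.2.1.2, p.2.1.1) 1 - Pi.single (p.1, p.2.1.2) 1 : Edge d L → R) e := by
  classical
  simp only [Pi.add_apply, Pi.sub_apply, Pi.single_apply, Int.cast_add, Int.cast_sub, Int.cast_ite,
    Int.cast_one, Int.cast_zero]

/-- **An integer certificate for every plaquette outside the `ℚ`-span**: if `σ∂p'` is not a rational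
combination of `{σ∂p : p ∈ B}`, there is `θ : links → ℤ` with `Σ_e θ_e·σ∂p(e) = 0` for every `p ∈ B` and
`Σ_e θ_e·σ∂p'(e) ≠ 0` (a separating `ℚ`-linear functional in coordinates, denominators cleared). [ours] -/
theorem exists_int_certificate_of_notMem_span (B : Finset (Plaquette d L)) (p' : Plaquette d L)
    (hp' : (Pi.single (p'.1, p'.2.1.1) 1 + Pi.single (p'.1.shift p'.2.1.1, p'.2.1.2) 1 -
        Pi.single (p'.1.shift p'.2.1.2, p'.2.1.1) 1 - Pi.single (p'.1, p'.2.1.2) 1 : Edge d L → ℚ) ∉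
      Submodule.span ℚ (Set.range fun p : B =>
        (Pi.single ((p : Plaquette d L).1, (p : Plaquette d L).2.1.1) 1 +
        Pi.single ((p : Plaquette d L).1.shift (p : Plaquette d L).2.1.1, (p : Plaquette d L).2.1.2) 1 -
        Pi.single ((p : Plaquette d L).1.shift (p : Plaquette d L).2.1.2, (p : Plaquette d L).2.1.1) 1 -
        Pi.single ((p : Plaquette d L).1, (p : Plaquette d L).2.1.2) 1 : Edge d L → ℚ))) :
    ∃ θ : Edge d L → ℤ,
      (∀ p ∈ B, ∑ e, θ e * (Pi.single (p.1, p.2.1.1) 1 + Pi.single (p.1.shift p.2.1.1, p.2.1.2) 1 -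
        Pi.single (p.1.shift p.2.1.2, p.2.1.1) 1 - Pi.single (p.1, p.2.1.2) 1 : Edge d L → ℤ) e = 0) ∧
      ∑ e, θ e * (Pi.single (p'.1, p'.2.1.1) 1 + Pi.single (p'.1.shift p'.2.1.1, p'.2.1.2) 1 -
        Pi.single (p'.1.shift p'.2.1.2, p'.2.1.1) 1 - Pi.single (p'.1, p'.2.1.2) 1 : Edge d L → ℤ) e ≠ 0 := by
  classical
  obtain ⟨f, hfne, hfW⟩ := Submodule.exists_dual_map_eq_bot_of_notMem hp' inferInstance
  have hfB : ∀ p ∈ B, f (Pi.single (p.1, p.2.1.1) 1 + Pi.single (p.1.shift p.2.1.1, p.2.1.2) 1 -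
        Pi.single (p.1.shift p.2.1.2, p.2.1.1) 1 - Pi.single (p.1, p.2.1.2) 1 : Edge d L → ℚ) = 0 := by
    intro p hp
    have hmem : f (Pi.single (p.1, p.2.1.1) 1 + Pi.single (p.1.shift p.2.1.1, p.2.1.2) 1 -
        Pi.single (p.1.shift p.2.1.2, p.2.1.1) 1 - Pi.single (p.1, p.2.1.2) 1 : Edge d L → ℚ) ∈
        (Submodule.span ℚ (Set.range fun p : B =>
          (Pi.single ((p : Plaquette d L).1, (p : Plaquette d L).2.1.1) 1 +
        Pi.single ((p : Plaquette d L).1.shift (p : Plaquette d L).2.1.1, (p : Plaquette d L).2.1.2) 1 -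
        Pi.single ((p : Plaquette d L).1.shift (p : Plaquette d L).2.1.2, (p : Plaquette d L).2.1.1) 1 -
        Pi.single ((p : Plaquette d L).1, (p : Plaquette d L).2.1.2) 1 : Edge d L → ℚ))).map f :=
      Submodule.mem_map_of_mem (Submodule.subset_span ⟨⟨p, hp⟩, rfl⟩)
    rw [hfW] at hmem
    exact (Submodule.mem_bot ℚ).1 hmem
  -- coordinates of `f`
  set θq : Edge d L → ℚ := fun e => f (fun j => if e = j then 1 else 0) with hθq
  have hf_apply : ∀ v : Edge d L → ℚ, f v = ∑ e, v e * θq e := fun v => by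
    rw [LinearMap.pi_apply_eq_sum_univ f v]
    rfl
  -- clear denominators
  set D : ℕ := ∏ e, (θq e).den with hD
  have hDpos : 0 < D := Finset.prod_pos fun e _ => (θq e).den_pos
  have hden : ∀ e, ((θq e).den : ℤ) ∣ (D : ℤ) := fun e => by
    rw [hD]; push_cast
    exact Finset.dvd_prod_of_mem (fun e => ((θq e).den : ℤ)) (Finset.mem_univ e)
  choose k hk using hden
  have hcoef : ∀ e, ((((θq e).num * k e : ℤ)) : ℚ) = (D : ℚ) * θq e := by
    intro e
    have h1 : ((D : ℤ) : ℚ) = (((θq e).den : ℤ) : ℚ) * (k e : ℚ) := by rw [hk e, Int.cast_mul]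
    rw [Int.cast_natCast] at h1
    rw [Int.cast_mul, h1, Int.cast_natCast, ← Rat.mul_den_eq_num (θq e)]
    ring
  have hsum : ∀ p : Plaquette d L, ((∑ e, ((θq e).num * k e) * (Pi.single (p.1, p.2.1.1) 1 + Pi.single (p.1.shift p.2.1.1, p.2.1.2) 1 -
        Pi.single (p.1.shift p.2.1.2, p.2.1.1) 1 - Pi.single (p.1, p.2.1.2) 1 : Edge d L → ℤ) e : ℤ) : ℚ) =
      (D : ℚ) * f (Pi.single (p.1, p.2.1.1) 1 + Pi.single (p.1.shift p.2.1.1, p.2.1.2) 1 -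
        Pi.single (p.1.shift p.2.1.2, p.2.1.1) 1 - Pi.single (p.1, p.2.1.2) 1 : Edge d L → ℚ) := by
    intro p
    rw [hf_apply, Finset.mul_sum]
    push_cast
    refine Finset.sum_congr rfl fun e _ => ?_
    rw [← Int.cast_mul ((θq e).num) (k e), hcoef e, intCast_signedBoundary_apply_eq (R := ℚ) p e]
    ring
  refine ⟨fun e => (θq e).num * k e, fun p hp => ?_, ?_⟩
  · have h := hsum p
    rw [hfB p hp, mul_zero] at h
    exact_mod_cast h
  · intro h0
    have h := hsum p'
    rw [h0, Int.cast_zero] at h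
    have hD0 : (D : ℚ) ≠ 0 := by exact_mod_cast hDpos.ne'
    exact hfne ((mul_eq_zero.1 h.symm).resolve_left hD0)

/-- **THE INTEGER CERTIFICATE.**  `L ≥ 2`; `B` any collection of plaquettes with `#B < (d−1)(L^d − 1)`.  There
are a plaquette `p'` and `θ : links → ℤ` with `Σ_e θ_e·σ∂p(e) = 0` for every `p ∈ B` and
`Σ_e θ_e·σ∂p'(e) ≠ 0`. [ours] -/
theorem exists_int_certificate (hL : 2 ≤ L) (B : Finset (Plaquette d L))
    (hlt : B.card < (d - 1) * (L ^ d - 1)) :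
    ∃ (p' : Plaquette d L) (θ : Edge d L → ℤ),
      (∀ p ∈ B, ∑ e, θ e * (Pi.single (p.1, p.2.1.1) 1 + Pi.single (p.1.shift p.2.1.1, p.2.1.2) 1 -
        Pi.single (p.1.shift p.2.1.2, p.2.1.1) 1 - Pi.single (p.1, p.2.1.2) 1 : Edge d L → ℤ) e = 0) ∧
      ∑ e, θ e * (Pi.single (p'.1, p'.2.1.1) 1 + Pi.single (p'.1.shift p'.2.1.1, p'.2.1.2) 1 -
        Pi.single (p'.1.shift p'.2.1.2, p'.2.1.1) 1 - Pi.single (p'.1, p'.2.1.2) 1 : Edge d L → ℤ) e ≠ 0 := by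
  obtain ⟨p', hp'⟩ := exists_signedBoundary_notMem_span_rat hL B hlt
  obtain ⟨θ, hθ⟩ := exists_int_certificate_of_notMem_span B p' hp'
  exact ⟨p', θ, hθ⟩

/-! ## §3 The configuration `g^θ` -/

/-- `g^{Σ b} = ∏ g^{b_i}` for integer exponents in a commutative group. [ours] -/
theorem zpow_finset_sum_eq_prod {G : Type*} [CommGroup G] {ι : Type*} (g : G) (s : Finset ι) (b : ι → ℤ) :
    g ^ (∑ i ∈ s, b i) = ∏ i ∈ s, g ^ b i := by
  classical
  induction s using Finset.induction_on with
  | empty => simp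
  | insert a s ha ih => rw [Finset.sum_insert ha, Finset.prod_insert ha, zpow_add, ih]

/-- **The holonomy of `U = g^θ` around `p` is `g^{Σ_e θ_e σ∂p(e)}`** (`G` commutative). [ours] -/
theorem plaquetteHolonomy_zpow_config {G : Type*} [CommGroup G] (g : G) (θ : Edge d L → ℤ)
    (p : Plaquette d L) :
    plaquetteHolonomy (fun e => g ^ θ e) p.1 p.2.1.1 p.2.1.2 =
      g ^ (∑ e, θ e * (Pi.single (p.1, p.2.1.1) 1 + Pi.single (p.1.shift p.2.1.1, p.2.1.2) 1 -
        Pi.single (p.1.shift p.2.1.2, p.2.1.1) 1 - Pi.single (p.1, p.2.1.2) 1 : Edge d L → ℤ) e) := by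
  rw [plaquetteHolonomy_eq_prod_zpow, zpow_finset_sum_eq_prod]
  exact Finset.prod_congr rfl fun e _ => by rw [← zpow_mul]

omit [NeZero L] in
/-- The trivial configuration has holonomy `1` around every plaquette. [ours] -/
theorem plaquetteHolonomy_one_config {G : Type*} [CommGroup G] (p : Plaquette d L) :
    plaquetteHolonomy (fun _ : Edge d L => (1 : G)) p.1 p.2.1.1 p.2.1.2 = 1 := by
  simp [plaquetteHolonomy]

/-! ## §4 Non-determination below `(d−1)(L^d − 1)` plaquettes -/

/-- **NON-DETERMINATION.**  `L ≥ 2`; `B` ANY collection of plaquettes of `(ℤ/L)^d` with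
`#B < (d−1)(L^d − 1)`; `G` commutative with, for every `n ≠ 0`, an element `g` with `g^n ≠ 1` (`U(1)`, `ℤ`,
every group with an element of infinite order).  Then some plaquette `p' ∉ B` is NOT determined by `B`: two
`G`-configurations (namely `g^θ` for the certificate `θ` of §2, and the trivial one) have the same holonomy
around every `p ∈ B` but different holonomies around `p'`. [ours] -/
theorem exists_plaquetteHolonomy_not_determined (hL : 2 ≤ L) (B : Finset (Plaquette d L))
    (hlt : B.card < (d - 1) * (L ^ d - 1)) {G : Type*} [CommGroup G]
    (hG : ∀ n : ℤ, n ≠ 0 → ∃ g : G, g ^ n ≠ 1) :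
    ∃ p' : Plaquette d L, p' ∉ B ∧ ∃ U V : GaugeConfig d L G,
      (∀ p ∈ B, plaquetteHolonomy U p.1 p.2.1.1 p.2.1.2 = plaquetteHolonomy V p.1 p.2.1.1 p.2.1.2) ∧
      plaquetteHolonomy U p'.1 p'.2.1.1 p'.2.1.2 ≠ plaquetteHolonomy V p'.1 p'.2.1.1 p'.2.1.2 := by
  obtain ⟨p', θ, hB, hp'⟩ := exists_int_certificate hL B hlt
  obtain ⟨g, hg⟩ := hG _ hp'
  refine ⟨p', fun hmem => hp' (hB p' hmem), fun e => g ^ θ e, fun _ => 1, fun p hp => ?_, ?_⟩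
  · rw [plaquetteHolonomy_zpow_config, hB p hp, zpow_zero, plaquetteHolonomy_one_config]
  · rw [plaquetteHolonomy_zpow_config, plaquetteHolonomy_one_config]
    exact hg

/-- **The instance `G = ℤ`** (integer-valued link variables, written multiplicatively; `1 ∈ ℤ` has infinite
order): below `(d−1)(L^d − 1)` plaquettes some plaquette is not determined. [ours] -/
theorem exists_plaquetteHolonomy_not_determined_int (hL : 2 ≤ L) (B : Finset (Plaquette d L))
    (hlt : B.card < (d - 1) * (L ^ d - 1)) :
    ∃ p' : Plaquette d L, p' ∉ B ∧ ∃ U V : GaugeConfig d L (Multiplicative ℤ),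
      (∀ p ∈ B, plaquetteHolonomy U p.1 p.2.1.1 p.2.1.2 = plaquetteHolonomy V p.1 p.2.1.1 p.2.1.2) ∧
      plaquetteHolonomy U p'.1 p'.2.1.1 p'.2.1.2 ≠ plaquetteHolonomy V p'.1 p'.2.1.1 p'.2.1.2 := by
  refine exists_plaquetteHolonomy_not_determined hL B hlt fun n hn => ⟨Multiplicative.ofAdd (1 : ℤ), ?_⟩
  intro h
  rw [← ofAdd_zsmul, smul_eq_mul, mul_one] at h
  exact hn (Multiplicative.ofAdd.injective h)

/-- In `U(1)` (the unit circle of `ℂ`), for every `n ≠ 0` the element `e^{iπ/n}` has `n`-th power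
`e^{iπ} = −1 ≠ 1`. [ours] -/
theorem circle_exists_zpow_ne_one (n : ℤ) (hn : n ≠ 0) : ∃ g : Circle, g ^ n ≠ 1 := by
  refine ⟨Circle.exp (Real.pi / n), ?_⟩
  rw [← Circle.exp_zsmul, zsmul_eq_mul, mul_div_cancel₀ _ (Int.cast_ne_zero.2 hn)]
  intro h
  obtain ⟨m, hm⟩ := Circle.exp_eq_one.1 h
  have h1 : (1 : ℝ) * Real.pi = (2 * m) * Real.pi := by rw [one_mul]; nth_rw 1 [hm]; ring
  have h2 : (1 : ℝ) = 2 * m := mul_right_cancel₀ Real.pi_ne_zero h1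
  have h3 : (1 : ℤ) = 2 * m := by exact_mod_cast h2
  omega

/-- **The instance `G = U(1)`** (compact abelian lattice gauge theory): below `(d−1)(L^d − 1)` plaquettes some
plaquette holonomy is NOT determined by those of `B`. [ours] -/
theorem exists_plaquetteHolonomy_not_determined_circle (hL : 2 ≤ L) (B : Finset (Plaquette d L))
    (hlt : B.card < (d - 1) * (L ^ d - 1)) :
    ∃ p' : Plaquette d L, p' ∉ B ∧ ∃ U V : GaugeConfig d L Circle,
      (∀ p ∈ B, plaquetteHolonomy U p.1 p.2.1.1 p.2.1.2 = plaquetteHolonomy V p.1 p.2.1.1 p.2.1.2) ∧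
      plaquetteHolonomy U p'.1 p'.2.1.1 p'.2.1.2 ≠ plaquetteHolonomy V p'.1 p'.2.1.1 p'.2.1.2 :=
  exists_plaquetteHolonomy_not_determined hL B hlt circle_exists_zpow_ne_one

/-! ## §5 Ranked structures: determination ⇔ full -/

/-- A ranked structure of `(ℤ/L)^d` has at most `(d−1)(L^d − 1)` plaquettes (`L ≥ 2`; the homology bound of
`TorusRankedHomologyBound`, rearranged). [ours] -/
theorem card_le_of_ranked (hL : 2 ≤ L) (B : Finset (Plaquette d L))
    (t : Plaquette d L → Edge d L)
    (ht : ∀ p ∈ B, t p ∈ ({(p.1, p.2.1.1), (p.1.shift p.2.1.1, p.2.1.2),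
        (p.1.shift p.2.1.2, p.2.1.1), (p.1, p.2.1.2)} : Finset (Edge d L)))
    (rank : Plaquette d L → ℕ)
    (hrank : ∀ p ∈ B, ∀ p' ∈ B, p ≠ p' → t p ∈ ({(p'.1, p'.2.1.1), (p'.1.shift p'.2.1.1, p'.2.1.2),
        (p'.1.shift p'.2.1.2, p'.2.1.1), (p'.1, p'.2.1.2)} : Finset (Edge d L)) → rank p < rank p') :
    B.card ≤ (d - 1) * (L ^ d - 1) := by
  have h := card_add_card_site_add_le_card_edge_add_one_of_ranked hL B t ht rank hrank
  rw [Summit.Ventures.LatticeQCDFlow.Runbook.card_site, Summit.Ventures.LatticeQCDFlow.Runbook.card_edge] at h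
  have hX : 1 ≤ L ^ d := Nat.one_le_pow _ _ (by omega)
  rcases Nat.eq_zero_or_pos d with hd | hd
  · subst hd
    simp only [pow_zero, mul_zero, add_zero] at h
    simp only [Nat.zero_sub, zero_mul, nonpos_iff_eq_zero, Finset.card_eq_zero]
    have : B.card = 0 := by omega
    exact Finset.card_eq_zero.1 this
  · obtain ⟨Y, hY⟩ : ∃ Y, L ^ d = Y + 1 := ⟨L ^ d - 1, by omega⟩
    rw [hY] at h ⊢
    obtain ⟨e, rfl⟩ : ∃ e, d = e + 1 := ⟨d - 1, by omega⟩
    simp only [Nat.add_sub_cancel]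
    have h5 : (Y + 1) * (e + 1) = e * Y + Y + e + 1 := by ring
    rw [h5] at h
    nlinarith [h]

/-- **FOR RANKED STRUCTURES, DETERMINATION ⇔ FULL.**  `L ≥ 2`; `(B, t, rank)` ranked; `G` commutative with,
for every `n ≠ 0`, some `g^n ≠ 1` (`U(1)`: `circle_exists_zpow_ne_one`).
The covered holonomies determine the holonomy around every plaquette of every
`G`-configuration if and only if `#B = (d−1)(L^d − 1)` — i.e. (`TorusRankedMorseCount.isLeast_card_compl_ranked`)
iff `B` is OPTIMAL: the exact one-plaquette heat-bath autoregressions of an abelian field that leave nothing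
random outside are exactly the optimal ones. [ours] -/
theorem covered_determine_iff_card_eq (hL : 2 ≤ L) (B : Finset (Plaquette d L))
    (t : Plaquette d L → Edge d L)
    (ht : ∀ p ∈ B, t p ∈ ({(p.1, p.2.1.1), (p.1.shift p.2.1.1, p.2.1.2),
        (p.1.shift p.2.1.2, p.2.1.1), (p.1, p.2.1.2)} : Finset (Edge d L)))
    (rank : Plaquette d L → ℕ)
    (hrank : ∀ p ∈ B, ∀ p' ∈ B, p ≠ p' → t p ∈ ({(p'.1, p'.2.1.1), (p'.1.shift p'.2.1.1, p'.2.1.2),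
        (p'.1.shift p'.2.1.2, p'.2.1.1), (p'.1, p'.2.1.2)} : Finset (Edge d L)) → rank p < rank p')
    {G : Type*} [CommGroup G] (hG : ∀ n : ℤ, n ≠ 0 → ∃ g : G, g ^ n ≠ 1) :
    (∀ U V : GaugeConfig d L G, (∀ p ∈ B, plaquetteHolonomy U p.1 p.2.1.1 p.2.1.2 = plaquetteHolonomy V p.1 p.2.1.1 p.2.1.2) →
        ∀ p' : Plaquette d L, plaquetteHolonomy U p'.1 p'.2.1.1 p'.2.1.2 = plaquetteHolonomy V p'.1 p'.2.1.1 p'.2.1.2) ↔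
      B.card = (d - 1) * (L ^ d - 1) := by
  constructor
  · intro hdet
    by_contra hne
    have hlt : B.card < (d - 1) * (L ^ d - 1) :=
      lt_of_le_of_ne (card_le_of_ranked hL B t ht rank hrank) hne
    obtain ⟨p', -, U, V, hcov, hp'⟩ := exists_plaquetteHolonomy_not_determined hL B hlt hG
    exact hp' (hdet U V hcov p')
  · intro hcard U V hcov p'
    exact plaquetteHolonomy_eq_of_covered_eq hL B t ht rank hrank hcard U V hcov p'

end Summit.Ventures.LatticeQCDFlow.Theory2.Autoregressive
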